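import Summits.QuantumFields.YangMills.Theorems.BalabanUVNodesN15KingModelPotentialDressedPropagator
import Summits.QuantumFields.YangMills.Theorems.BalabanUVNodesN15KingModelFullPropagatorRiemannWeightedRate
import Summits.QuantumFields.YangMills.Theorems.BalabanUVNodesN15KingModelPotentialDressedRate

/-!
# BalabanUVNodes ∕ N15 — THE KING MODEL, PART 13b: THE (3.35)∕(3.36)-TYPE LETTERS OF THE DRESSED FLUCTUATION PROPAGATOR `G_{k,v}` ALONG
# KING'S RUN — uniform (weighted) Riemann MASS and Riemann-sum two-spacing RATE, uniformly in `k`, the volume and the potential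
# (Track A, DAG node N15 = NE2; FAN-OUT v1.1 §N15 s3 «KING-MODEL RUNG … what the curved case adds»)

HONEST FRAMING.  Count-neutral kernel bookkeeping (cell `pub-ymgap`, seat `pub-ymgap-dag-n15-d` g8; `--supports stmt-QuantumFields-20292
--as helper` = K3⁗ `SpineGivenEndpointR13Sep`; lineage K3 19676 → K3′ 19908 → K3‴ 19912).  THEOREMS ONLY (0 `def`, 0 `sorry`), standard axioms.
King's `A = 0` SCALAR model on the King-admissible unit tori `Π ℤ∕(2L^{e+1})` (odd `L ≥ 3`, `m² > 0`), the fluctuation propagator dressed by a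
POTENTIAL TOWER `v` (part 13a `dressedProp`); the potential is a multiplication operator, NOT Bałaban's gauge-field background; [B9] prints for
`G_k(U)` analyticity in `U` (Thm 3.4) and η-uniform regularity, never an η-difference; NOT a node discharge; nothing continuum ∕ ℝ⁴ ∕ OS ∕
mass-gap ∕ Clay.
THE POINT.  ★★ **`dressedProp_letters_kingU`** — there are `w̄, C, δ, c > 0` (functions of `d, L, a, m²`) such that for every volume exponent `e`,
every potential tower `v` with `sup_{N,x}|v_N(x)| ≤ w₀ ≤ w̄` and coherence `sup_{x′}|v_{L·L^k}(x′) − v_{L^k}(x)| ≤ ν₀s^k` (`0 ≤ s ≤ L^{−1∕2}`), and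
every `k ≥ 1`:
(SIZE, the (3.35)-type letter) `N^{−(d+1)}Σ_y |G_{k,v}(x, y)|·e^{δ′|B x − B y|} ≤ C` for every `0 ≤ δ′ ≤ δ` and every `x` — the dressed propagator is a
bounded operator on `ℓ^∞` with exponentially decaying Riemann tails, uniformly in `k`, the volume and the potential (13a on 11a's weighted mass);
(RATE, the (3.36)-type letter) `N′^{−(d+1)}Σ_{y′} |G_{k+1,v}(x′, y′) − G_{k,v}(x, y)| ≤ c·((L^{−1∕2})^k + ν₀s^k)` for every `x′` (`x, y` under `x′, y′`)
— the two-spacing rate of the dressed propagator in the row-uniform Riemann-sum norm (13a on 10a's Riemann mass and rate).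
WHAT THE CURVED CASE ADDS (one line): the same two letters for Bałaban's covariant `G_k(U)` uniformly over the live window `Reg335∕Reg336 c35 α₀ U`
([B9] (3.35)–(3.36)) — a non-abelian background field `U` in place of a scalar potential, curved covariant derivatives in `A₀`.
HONEST SCOPE.  King-admissible tori only; Riemann-sum (ℓ^∞-operator) statements, not pointwise kernel bounds; window depends on `m²`; scalar
potential, `A = 0`; not a discharge.
Locators: [King1986] C. King, CMP **102** (1986) 649–677: (2.13) p. 653, Theorem 3.3 (3.7) p. 658, Prop. 3.8 (3.71) p. 664 and p. 664 (pairing),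
(4.44) p. 675; [B9] = [Balaban1985BackgroundPropagators] CMP **99** (1985): (3.35)–(3.36) p. 396 (slots), Thm 3.4 p. 400, Thm 3.14 pp. 426–427.
-/

noncomputable section

open scoped BigOperators Matrix
open Finset

namespace Summit.QuantumFields.YangMills.BalabanUVNodes.N15.KingModel

open Literature.MathematicalPhysics.QuantumFieldTheory.Balaban1983to89 hiding blockOf
open Literature.MathematicalPhysics.QuantumFieldTheory.Balaban1983to89.B4Sect5Proof (latticeConst latticeConst_nonneg)
open Literature.MathematicalPhysics.QuantumFieldTheory.Balaban1983to89.B5Prop11Plancherel (Tor fine)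
open Literature.MathematicalPhysics.QuantumFieldTheory.King1986 (aK aK_pos)
open Literature.MathematicalPhysics.QuantumFieldTheory.King1986.Torus
open Summit.QuantumFields.YangMills.BalabanUVNodes.N15KingModelRung.Curved (underPtN val_underPtN blockOf_underPtN)

variable {d : ℕ}

section Run

open Real

variable (L : ℕ) [NeZero L]

/-- **THE (3.35)∕(3.36)-TYPE LETTERS OF THE DRESSED FLUCTUATION PROPAGATOR ALONG KING'S RUN** (module docstring).  For odd `L ≥ 3`, `a, m² > 0`
there are `w̄, C, δ, c > 0` such that for every volume exponent `e`, every potential tower `v` on the fine tori over `Π ℤ∕(2L^{e+1})` with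
`sup|v_N| ≤ w₀ ≤ w̄`, `0 ≤ ν₀`, `0 ≤ s ≤ L^{−1∕2}`, coherence `|v_{L·L^k}(x′) − v_{L^k}(x)| ≤ ν₀s^k` (`k ≥ 1`), and every `k ≥ 1`:
(SIZE) `∀ 0 ≤ δ′ ≤ δ ∀ x, N^{−(d+1)}Σ_y|G_{k,v}(x,y)|e^{δ′|Bx − By|} ≤ C`;  (RATE) `∀ x′, N′^{−(d+1)}Σ_{y′}|G_{k+1,v}(x′,y′) − G_{k,v}(x,y)| ≤ c((L^{−1∕2})^k + ν₀s^k)`,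
`G_{k,v} = dressedProp (L^k) U (a_k) m² ((L^k)²) (v_{L^k})`.
[cite: King1986, (2.13) p.653, Theorem 3.3 (3.7) p.658, Prop. 3.8 (3.71) p.664; Balaban1985BackgroundPropagators, (3.35)–(3.36) p.396 (slots)] -/
theorem dressedProp_letters_kingU (hLodd : Odd L) (hL : 2 ≤ L) {a m2 : ℝ} (ha : 0 < a) (hm : 0 < m2) :
    ∃ wb C δ c : ℝ, 0 < wb ∧ 0 < C ∧ 0 < δ ∧ 0 < c ∧ ∀ (e : ℕ) (v : ∀ N : ℕ, Tor (fine N (kingU d L e)) → ℝ) (w₀ ν₀ s : ℝ),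
      (∀ (N : ℕ) (x : Tor (fine N (kingU d L e))), |v N x| ≤ w₀) → w₀ ≤ wb → 0 ≤ ν₀ → 0 ≤ s → s ≤ (L : ℝ) ^ (-(1 / 2 : ℝ)) →
      (∀ (k : ℕ), 1 ≤ k → ∀ x' : Tor (fine (L ^ 1 * L ^ k) (kingU d L e)),
          |v (L ^ 1 * L ^ k) x' - v (L ^ k) (underPtN L k 1 (kingU d L e) x')| ≤ ν₀ * s ^ k) →
      ∀ (k : ℕ), 1 ≤ k →
        (∀ (δ' : ℝ), 0 ≤ δ' → δ' ≤ δ → ∀ x : Tor (fine (L ^ k) (kingU d L e)),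
          (((L ^ k : ℕ) : ℝ) ^ (d + 1))⁻¹ *
              ∑ y, |dressedProp (L ^ k) (kingU d L e) (aK a L k) m2 (((L ^ k : ℕ) : ℝ) ^ 2) (v (L ^ k)) x y|
                * Real.exp (δ' * tdistT (kingU d L e) (blockOf (L ^ k) (kingU d L e) x) (blockOf (L ^ k) (kingU d L e) y)) ≤ C) ∧
        (∀ x' : Tor (fine (L ^ 1 * L ^ k) (kingU d L e)),
          (((L ^ 1 * L ^ k : ℕ) : ℝ) ^ (d + 1))⁻¹ *
              ∑ y', |dressedProp (L ^ 1 * L ^ k) (kingU d L e) (aK a L (k + 1)) m2 (((L ^ 1 * L ^ k : ℕ) : ℝ) ^ 2) (v (L ^ 1 * L ^ k)) x' y'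
                - dressedProp (L ^ k) (kingU d L e) (aK a L k) m2 (((L ^ k : ℕ) : ℝ) ^ 2) (v (L ^ k))
                    (underPtN L k 1 (kingU d L e) x') (underPtN L k 1 (kingU d L e) y')|
            ≤ c * (((L : ℝ) ^ (-(1 / 2 : ℝ))) ^ k + ν₀ * s ^ k)) := by
  have hL1 : 1 < L := by omega
  have hLr : (1 : ℝ) < L := by exact_mod_cast hL1
  -- the Riemann constants of the undressed propagator (parts 10a, 11a) and the window of 9c
  obtain ⟨δW, CW, hδW, hCW, HW⟩ := fullProp_riemannMassW_unif (d := d) L hLodd hL ha hm.le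
  obtain ⟨CM, hCM, HM⟩ := fullProp_riemannMass_unif (d := d) L hLodd hL ha hm.le
  obtain ⟨CR, hCR, HR⟩ := fullProp_riemannRate_unif (d := d) L hLodd hL ha hm.le (γ := 1) zero_le_one le_rfl
  obtain ⟨-, -, hwbar⟩ := dressedConsts_nonneg (d := d) ha hL
  set Cb : ℝ := max CW CM with hCbdef
  have hCb : 0 < Cb := lt_max_of_lt_left hCW
  have hCWb : CW ≤ Cb := le_max_left _ _
  have hCMb : CM ≤ Cb := le_max_right _ _
  set wb : ℝ := min (wbarK (d + 1) a L) (1 / (2 * Cb)) with hwbdef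
  have hwb : 0 < wb := lt_min hwbar (by positivity)
  set c : ℝ := 4 * CR + 4 * Cb ^ 2 + 1 with hcdef
  have hc : 0 < c := by positivity
  refine ⟨wb, 2 * Cb, δW, c, hwb, by positivity, hδW, hc, fun e v w₀ ν₀ s hv hw hν₀ hs0 hs1 hcoh k hk1 => ?_⟩
  set r : ℝ := (L : ℝ) ^ (-(1 / 2 : ℝ)) with hrdef
  have hr0 : 0 ≤ r := Real.rpow_nonneg (Nat.cast_nonneg _) _
  have hw₀ : 0 ≤ w₀ := (abs_nonneg _).trans (hv 0 fun _ => 0)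
  have hM' : ∀ μ, kingU d L e μ = 2 * L ^ (e + 1) := fun μ => by
    show L * (2 * L ^ e) = 2 * L ^ (e + 1)
    ring
  have hN' : L ^ 1 * L ^ k = L ^ (k + 1) := by ring
  have hak : 0 < aK a L k := aK_pos ha hLr hk1
  have hak' : 0 < aK a L (k + 1) := aK_pos ha hLr (by omega)
  -- the window and the invertibility of the two runs' operators
  have hwbar' : w₀ ≤ wbarK (d + 1) a L := hw.trans (min_le_left _ _)
  have hwin : Cb * w₀ ≤ 1 / 2 := by
    have h1 : w₀ ≤ 1 / (2 * Cb) := hw.trans (min_le_right _ _)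
    rw [le_div_iff₀ (by positivity)] at h1
    linarith
  have hlo : ∀ (N : ℕ) (x : Tor (fine N (kingU d L e))), -w₀ ≤ v N x := fun N x => (abs_le.mp (hv N x)).1
  have hA : IsUnit (fineOp (L ^ k) (kingU d L e) (aK a L k) (((L ^ k : ℕ) : ℝ) ^ 2) m2) :=
    fineOp_isUnit _ _ hak.le (by positivity) hm
  have hA' : IsUnit (fineOp (L ^ 1 * L ^ k) (kingU d L e) (aK a L (k + 1)) (((L ^ 1 * L ^ k : ℕ) : ℝ) ^ 2) m2) :=
    fineOp_isUnit _ _ hak'.le (by positivity) hm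
  have hB : IsUnit (fineOpPot (L ^ k) (kingU d L e) (aK a L k) (((L ^ k : ℕ) : ℝ) ^ 2) m2 (v (L ^ k))) :=
    fineOpPot_isUnit hak.le hm.le (hlo (L ^ k)) (by
      obtain ⟨-, -, hgap, -⟩ := gap_unif (d := d) ha hL hk1 hwbar'
      have hP : 0 ≤ (2 * ((d + 1 : ℕ) : ℝ) + aK a L k) * (4 * kapCT (d + 1) a L) ^ 2 := by positivity
      linarith)
  have hB' : IsUnit (fineOpPot (L ^ 1 * L ^ k) (kingU d L e) (aK a L (k + 1)) (((L ^ 1 * L ^ k : ℕ) : ℝ) ^ 2) m2 (v (L ^ 1 * L ^ k))) :=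
    fineOpPot_isUnit hak'.le hm.le (hlo (L ^ 1 * L ^ k)) (by
      obtain ⟨-, -, hgap, -⟩ := gap_unif (d := d) ha hL (by omega : 1 ≤ k + 1) hwbar'
      have hP : 0 ≤ (2 * ((d + 1 : ℕ) : ℝ) + aK a L (k + 1)) * (4 * kapCT (d + 1) a L) ^ 2 := by positivity
      linarith)
  have hwk : ∀ y, |v (L ^ k) y| ≤ w₀ := hv (L ^ k)
  have hwk' : ∀ y', |v (L ^ 1 * L ^ k) y'| ≤ w₀ := hv (L ^ 1 * L ^ k)
  refine ⟨fun δ' hδ0 hδ1 x => ?_, fun x' => ?_⟩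
  · -- (SIZE): 13a's weighted ℓ^∞-operator Neumann on 11a's weighted mass (at `C_b ≥ C_W`)
    have hmassW : ∀ x : Tor (fine (L ^ k) (kingU d L e)), (((L ^ k : ℕ) : ℝ) ^ (d + 1))⁻¹ *
        ∑ y, |constrainedProp (L ^ k) (kingU d L e) (aK a L k) (((L ^ k : ℕ) : ℝ) ^ 2) m2 x y|
          * Real.exp (δ' * tdistT (kingU d L e) (blockOf (L ^ k) (kingU d L e) x) (blockOf (L ^ k) (kingU d L e) y)) ≤ Cb :=
      fun x => (HW k hk1 δ' hδ0 hδ1 (L ^ k) rfl (e + 1) (kingU d L e) hM' m2 hm le_rfl x).trans hCWb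
    exact dressedProp_riemannMassW_le hA hB hCb.le hδ0 hmassW hwk hwin x
  · -- (RATE): 13a's two-run ℓ^∞ step on 10a's mass (both runs) and rate
    have hmass : ∀ x : Tor (fine (L ^ k) (kingU d L e)), (((L ^ k : ℕ) : ℝ) ^ (d + 1))⁻¹ *
        ∑ y, |constrainedProp (L ^ k) (kingU d L e) (aK a L k) (((L ^ k : ℕ) : ℝ) ^ 2) m2 x y| ≤ Cb :=
      fun x => (HM k hk1 (L ^ k) rfl (e + 1) (kingU d L e) hM' m2 hm le_rfl x).trans hCMb
    have hmass' : ∀ x' : Tor (fine (L ^ 1 * L ^ k) (kingU d L e)), (((L ^ 1 * L ^ k : ℕ) : ℝ) ^ (d + 1))⁻¹ *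
        ∑ y', |constrainedProp (L ^ 1 * L ^ k) (kingU d L e) (aK a L (k + 1)) (((L ^ 1 * L ^ k : ℕ) : ℝ) ^ 2) m2 x' y'| ≤ Cb :=
      fun x' => (HM (k + 1) (by omega) (L ^ 1 * L ^ k) hN' (e + 1) (kingU d L e) hM' m2 hm le_rfl x').trans hCMb
    have hrate : ∀ x' : Tor (fine (L ^ 1 * L ^ k) (kingU d L e)), (((L ^ 1 * L ^ k : ℕ) : ℝ) ^ (d + 1))⁻¹ *
        ∑ y', |constrainedProp (L ^ 1 * L ^ k) (kingU d L e) (aK a L (k + 1)) (((L ^ 1 * L ^ k : ℕ) : ℝ) ^ 2) m2 x' y'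
          - constrainedProp (L ^ k) (kingU d L e) (aK a L k) (((L ^ k : ℕ) : ℝ) ^ 2) m2 (underPtN L k 1 (kingU d L e) x')
            (underPtN L k 1 (kingU d L e) y')| ≤ CR * r ^ k :=
      fun x' => HR k hk1 1 le_rfl (e + 1) (kingU d L e) hM' m2 hm le_rfl x'
    have h := dressedProp_riemannRate_le L hak.le hak'.le hm hB hB' hCb.le (by positivity : 0 ≤ CR * r ^ k)
      hmass hmass' hrate hwk hwk' (hcoh k hk1) hwin x'
    refine h.trans ?_
    -- bookkeeping: `2(R + R·w₀·2C_b + C_b·ν·2C_b) ≤ c·(r^k + ν₀s^k)` with `R = C_R r^k`, `ν = ν₀s^k`, `2w₀C_b ≤ 1`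
    have hνs : 0 ≤ ν₀ * s ^ k := by positivity
    have hrk : 0 ≤ r ^ k := pow_nonneg hr0 k
    have h1 : CR * r ^ k * (w₀ * (2 * Cb)) ≤ CR * r ^ k := by
      have : w₀ * (2 * Cb) ≤ 1 := by nlinarith
      exact mul_le_of_le_one_right (by positivity) this
    have h2 : Cb * (ν₀ * s ^ k * (2 * Cb)) = 2 * Cb ^ 2 * (ν₀ * s ^ k) := by ring
    rw [h2]
    have h3 : 2 * (CR * r ^ k + CR * r ^ k + 2 * Cb ^ 2 * (ν₀ * s ^ k)) ≤ c * (r ^ k + ν₀ * s ^ k) := by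
      rw [hcdef]
      nlinarith [mul_nonneg hCR.le hrk, mul_nonneg (sq_nonneg Cb) hνs, mul_nonneg hCR.le hνs, mul_nonneg (sq_nonneg Cb) hrk]
    nlinarith [h1, h3]

end Run

end Summit.QuantumFields.YangMills.BalabanUVNodes.N15.KingModel

end
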